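import Summits.QuantumFields.YangMills.Theorems.SwapVirialDeficitBlowUpScalingIntegrand
import Summits.QuantumFields.YangMills.Theorems.SwapVirialDeficitBlowUpGnomonicFollowerChart
import Summits.QuantumFields.YangMills.Theorems.SwapVirialDeficitBlowUpGnomonicLeaderChart
import Summits.QuantumFields.YangMills.Theorems.SwapVirialDeficitBlowUpGnomonicEulerJacobian
import HarnessLib

/-!
# G1-joint: the σ-glued ring measure in the JOINT gnomonic chart — one product-space statement

fcl-p3 g46's request (ym-idea-1 STATUS 14:03:45Z) for the virial assembly (V2′ ∕ B): merge the ring chart, the leaders' (iterated) gnomonic chart and the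
followers' (product) gnomonic chart into ONE sum over the hemisphere signs `ε : GnoSign L` of ONE Lebesgue integral over `η : GnoCoord L`
(`= (ℝ³)² × ℝ³ × (ℝ³)^{Fol L}`) against the density `gnoDensity η = ρ(x)ρ(y)ρ(z)·∏_f ρ(η_f)`, hub `a` on the cone outside:

* §1 ★ `sum_lintegral_sum_lintegral_mul` — the MERGE LEMMA `Σ_{e₁}∫_x (Σ_{e₂}∫_y Φ e₁ e₂ (x,y) dν)·w(x) dμ = Σ_{(e₁,e₂)} ∫ Φ·(w∘fst) d(μ⊗ν)` (Tonelli,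
  finite sums; measurable `Φ`, `w`, s-finite `ν`);
* §2 `blowUpPoint_one_gnomonicPoint`, `prod_ofReal_eq_ofReal_piWeight`, `measurable_ofReal_gnomonicWeight_div`, ★ `gnomonic_weights_eq`
  (`(2π²)^{-|Fol|}·ρ_F·(w₃/4)·(w₂/4·w₁/4) = (1/64)(2π²)^{-|Fol|}·gnoDensity` in `[0,∞]`), `gnomonic_weights_rearrange`;
* §3 `measurable_gnomonic_integrand`, ★★ `gnomonic_fibre_eq` — over a fixed hub `a`: the leaders' iterated chart with the followers' Haar integral inside
  `= ofReal((1/64)(2π²)^{-|Fol L|}) · Σ_{ε : GnoSign L} ∫_{η : GnoCoord L} G(fixHistory (ringConfig χ (blowUpPoint 1 (gnomonicPoint a ε η))))·gnoDensity η dη`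
  (✓`lintegral_haar_pi_eq_gnomonic` inside, the merge lemma three times: `(ε₃,v₃)+(ε_F,η_F)`, `(ε₁,v₁)+(ε₂,v₂)`, then the two pairs);
* §4 ★★★ `lintegral_ringMeasure_eq_gnomonic (κ) (hχ : χ central) (hG : Measurable G) (hinv : seam-gauge invariance)` —
  `∫ G dμ_L = ofReal(coneConst³/64 · (2π²)^{-|Fol L|}) · ∫_cone (Σ_ε ∫_η G(fixHistory (ringConfig χ (blowUpPoint 1 (gnomonicPoint a ε η))))·gnoDensity η dη) da`
  — no side condition, both hemispheres of every letter, whole `(ℝ³)^{3+|Fol L|}` (✓`lintegral_ringMeasure_eq_chart`, Tonelli, ✓`lintegral_haar_four_eq_gnomonicLeaderChart`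
  on the class function `C ↦ ∫ G dHaar^{Fol}` (✓`lintegral_pi_chart_conj`), `gnomonic_fibre_eq`); ★ `gnomonic_total_mass` (`G ≡ 1`).

HONEST LABEL: an exact change of variables at fixed `L` (measure-theory plumbing for the window programme of a DRAFT line); no estimate on ⟨24197⟩
(window-uniform, OPEN); ⟨24194⟩ ∕ ⟨24497⟩ OPEN; own crux ⟨22884⟩ OPEN (blocked-on ⟨19935⟩); no crux, rung of record or summit is proved; the Yang–Mills mass
gap is NOT proved; no summit is proved by a line.  THEOREMS ONLY (0 `def`, 0 `sorry`), standard axioms; `set_option synthInstance.maxSize 1024` for the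
4-fold product instances (as in ✓`…BlowUpGnomonicEulerJacobian`).  Width seat ym-line-sfw-p2-w2 g57 (cell ym-idea-1, free hands), `--supports stmt-QuantumFields-24197`.
References: [cite: tHooft1979]; [cite: Luscher1983, §2]; [cite: Chatterjee2026YMHiggs, Lemma 5.1 (Haar on SU(2) in coordinates)]; [folklore].
-/

set_option autoImplicit false
set_option synthInstance.maxSize 1024

noncomputable section

open MeasureTheory Quaternion Set
open scoped Quaternion ENNReal BigOperators
open Literature.MathematicalPhysics.QuantumLattice
open Literature.MathematicalPhysics.QuantumFieldTheory hiding SU2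
open Summit.QuantumFields.YangMills.Theorems.SwapTwistDeficit.ToronLog

attribute [local instance] Literature.Analysis.FluidPDE.Tao2016.quatMeasurableSpace
  Literature.Analysis.FluidPDE.Tao2016.quatBorelSpace
  Literature.MathematicalPhysics.QuantumLattice.secondCountableTopology_su2

namespace Summit.QuantumFields.YangMills.Theorems.SwapVirialDeficit.BlowUpRing

open Summit.QuantumFields.YangMills.Theorems.FemtoTransferGap
open Summit.QuantumFields.YangMills.Theorems.FemtoTransferGap.TT
open Summit.QuantumFields.YangMills.Theorems.VirialFluxGap.RingDeficit
open Summit.QuantumFields.YangMills.Theorems.SwapVirialDeficit.SwapRing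
open Summit.QuantumFields.YangMills.Theorems.SwapVirialDeficit.ZeroModeSigma (dil3 dilateIm)
open Summit.QuantumFields.YangMills.Theorems.SwapVirialDeficit.BlowUp (leaderTuple measurable_leaderTuple dil3_one' dilateIm_one_apply)
open Summit.QuantumFields.YangMills.Theorems.SwapVirialDeficit.Gnomonic (gnomonicWeight normSq3 piWeight continuous_gnomonicWeight gnomonicWeight_pos
  piWeight_pos)

variable {L : ℕ} [NeZero L]

/-! ## §1 Generic: merging an iterated sum–integral into a sum–integral over the product -/

section Merge

variable {E₁ E₂ : Type*} [Fintype E₁] [Fintype E₂] {X Y : Type*} [MeasurableSpace X] [MeasurableSpace Y]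

/-- ★ **MERGE LEMMA** (Tonelli + finite sums): for measurable `Φ e₁ e₂ : X × Y → [0,∞]` and a measurable weight `w` on `X`,
`Σ_{e₁} ∫_x (Σ_{e₂} ∫_y Φ e₁ e₂ (x,y) dν) · w(x) dμ = Σ_{(e₁,e₂)} ∫_{(x,y)} Φ e₁ e₂ (x,y) · w(x) d(μ ⊗ ν)`. [folklore] -/
theorem sum_lintegral_sum_lintegral_mul (μ : Measure X) (ν : Measure Y) [SFinite ν] {Φ : E₁ → E₂ → X × Y → ℝ≥0∞}
    (hΦ : ∀ e₁ e₂, Measurable (Φ e₁ e₂)) {w : X → ℝ≥0∞} (hw : Measurable w) :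
    ∑ e₁, ∫⁻ x, (∑ e₂, ∫⁻ y, Φ e₁ e₂ (x, y) ∂ν) * w x ∂μ = ∑ e : E₁ × E₂, ∫⁻ p, Φ e.1 e.2 p * w p.1 ∂(μ.prod ν) := by
  rw [Fintype.sum_prod_type]
  refine Finset.sum_congr rfl fun e₁ _ => ?_
  have hsec : ∀ e₂, Measurable fun x => ∫⁻ y, Φ e₁ e₂ (x, y) ∂ν := fun e₂ => (hΦ e₁ e₂).lintegral_prod_right'
  calc ∫⁻ x, (∑ e₂, ∫⁻ y, Φ e₁ e₂ (x, y) ∂ν) * w x ∂μ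
      = ∫⁻ x, ∑ e₂, (∫⁻ y, Φ e₁ e₂ (x, y) ∂ν) * w x ∂μ := by simp_rw [Finset.sum_mul]
    _ = ∑ e₂, ∫⁻ x, (∫⁻ y, Φ e₁ e₂ (x, y) ∂ν) * w x ∂μ := lintegral_finsetSum _ fun e₂ _ => (hsec e₂).mul hw
    _ = ∑ e₂, ∫⁻ p, Φ e₁ e₂ p * w p.1 ∂(μ.prod ν) := Finset.sum_congr rfl fun e₂ _ => by
        rw [lintegral_prod (fun p : X × Y => Φ e₁ e₂ p * w p.1)
          (show Measurable fun p : X × Y => Φ e₁ e₂ p * w p.1 from (hΦ e₁ e₂).mul (hw.comp measurable_fst)).aemeasurable]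
        refine lintegral_congr fun x => ?_
        show (∫⁻ y, Φ e₁ e₂ (x, y) ∂ν) * w x = ∫⁻ y, Φ e₁ e₂ (x, y) * w x ∂ν
        rw [lintegral_mul_const (w x) (show Measurable (fun y => Φ e₁ e₂ (x, y)) from (hΦ e₁ e₂).comp measurable_prodMk_left)]

end Merge

/-! ## §2 Small identities -/

omit [NeZero L] in
/-- At `t = 1` the blow-up of the gnomonic point is the plain letter configuration. [folklore] -/
theorem blowUpPoint_one_gnomonicPoint (a : ℍ) (ε : GnoSign L) (η : GnoCoord L) :
    blowUpPoint (L := L) 1 (gnomonicPoint a ε η) =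
      (leaderTuple a ((gnoLetter ε.1.1 η.1.1, gnoLetter ε.1.2 η.1.2), gnoLetter ε.2.1 η.2.1), fun i => quatToSU2 (gnoLetter (ε.2.2 i) (η.2.2 i))) := by
  simp only [blowUpPoint, gnomonicPoint, dil3_one', dilateIm_one_apply]

/-- The follower product weight of ✓`lintegral_haar_pi_eq_gnomonic` is `ofReal (piWeight η)`. [folklore] -/
theorem prod_ofReal_eq_ofReal_piWeight {ι : Type*} [Fintype ι] (η : ι → Fin 3 → ℝ) :
    ∏ i, ENNReal.ofReal (((1 + ∑ j, η i j ^ 2)⁻¹) ^ 2) = ENNReal.ofReal (piWeight η) := by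
  rw [piWeight, ENNReal.ofReal_prod_of_nonneg fun i _ => (gnomonicWeight_pos (η i)).le]
  rfl

/-- The one-letter weight `v ↦ ofReal (w(v)/4)` is measurable. [folklore] -/
theorem measurable_ofReal_gnomonicWeight_div : Measurable fun v : Fin 3 → ℝ => ENNReal.ofReal (gnomonicWeight v / 4) :=
  ENNReal.measurable_ofReal.comp (continuous_gnomonicWeight.div_const 4).measurable

/-- ★ The weights merge: `(2π²)^{-|Fol|}·ρ_F · w₃/4 · (w₂/4 · w₁/4) = (1/64)(2π²)^{-|Fol|} · gnoDensity`. [folklore] -/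
theorem gnomonic_weights_eq (η : GnoCoord L) :
    ENNReal.ofReal (1 / (2 * Real.pi ^ 2)) ^ Fintype.card (Fol L) * ENNReal.ofReal (piWeight η.2.2) * ENNReal.ofReal (gnomonicWeight η.2.1 / 4) *
        (ENNReal.ofReal (gnomonicWeight η.1.2 / 4) * ENNReal.ofReal (gnomonicWeight η.1.1 / 4)) =
      ENNReal.ofReal (1 / 64 * (1 / (2 * Real.pi ^ 2)) ^ Fintype.card (Fol L)) * ENNReal.ofReal (gnoDensity η) := by
  have h0 : (0 : ℝ) ≤ 1 / (2 * Real.pi ^ 2) := by positivity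
  have h1 := (piWeight_pos η.2.2).le
  have h2 := (gnomonicWeight_pos η.2.1).le
  have h3 := (gnomonicWeight_pos η.1.2).le
  have e1 : (0 : ℝ) ≤ (1 / (2 * Real.pi ^ 2)) ^ Fintype.card (Fol L) := pow_nonneg h0 _
  have e2 : (0 : ℝ) ≤ (1 / (2 * Real.pi ^ 2)) ^ Fintype.card (Fol L) * piWeight η.2.2 := mul_nonneg e1 h1
  have e3 : (0 : ℝ) ≤ (1 / (2 * Real.pi ^ 2)) ^ Fintype.card (Fol L) * piWeight η.2.2 * (gnomonicWeight η.2.1 / 4) :=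
    mul_nonneg e2 (div_nonneg h2 (by norm_num))
  have e4 : (0 : ℝ) ≤ gnomonicWeight η.1.2 / 4 := div_nonneg h3 (by norm_num)
  have e5 : (0 : ℝ) ≤ 1 / 64 * (1 / (2 * Real.pi ^ 2)) ^ Fintype.card (Fol L) := by positivity
  rw [← ENNReal.ofReal_pow h0, ← ENNReal.ofReal_mul e1, ← ENNReal.ofReal_mul e2, ← ENNReal.ofReal_mul e4, ← ENNReal.ofReal_mul e3,
    ← ENNReal.ofReal_mul e5]
  congr 1
  unfold gnoDensity
  ring

/-- Rearrangement of the merged integrand (pure commutative-semiring algebra in `[0,∞]`). [folklore] -/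
theorem gnomonic_weights_rearrange {c g p w₃ w₂ w₁ K D : ℝ≥0∞} (h : c * p * w₃ * (w₂ * w₁) = K * D) :
    c * (g * (p * w₃)) * (w₂ * w₁) = K * (g * D) := by
  rw [show c * (g * (p * w₃)) * (w₂ * w₁) = g * (c * p * w₃ * (w₂ * w₁)) by ring, h]
  ring

/-! ## §3 The fibre over a hub: followers' gnomonic chart inside the leaders' iterated chart, merged -/

/-- Measurability of the joint gnomonic integrand at a fixed hub and sign pattern. [folklore] -/
theorem measurable_gnomonic_integrand (χ : Site 3 L → SU2) {G : (Fin (2 * L - 1 + 1) → GaugeConfig 3 L SU2) × (Site 3 L → SU2) → ℝ≥0∞}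
    (hG : Measurable G) (a : ℍ) (ε : GnoSign L) :
    Measurable fun η : GnoCoord L => G (fixHistory (ringConfig χ (blowUpPoint 1 (gnomonicPoint a ε η)))) :=
  hG.comp (measurable_fixHistory.comp ((measurable_ringConfig χ).comp ((measurable_blowUpPoint 1).comp (measurable_gnomonicPoint a ε))))

/-- ★★ **THE FIBRE OVER A HUB, MERGED**: for measurable `G ≥ 0` and every hub `a`, the leaders' iterated gnomonic chart with the followers' Haar
integral inside equals ONE sum over `ε : GnoSign L` of ONE integral over `η : GnoCoord L` against `gnoDensity`, constant `(1/64)(2π²)^{-|Fol L|}`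
(✓`lintegral_haar_pi_eq_gnomonic` inside, `sum_lintegral_sum_lintegral_mul` three times). [folklore] -/
theorem gnomonic_fibre_eq (χ : Site 3 L → SU2) {G : (Fin (2 * L - 1 + 1) → GaugeConfig 3 L SU2) × (Site 3 L → SU2) → ℝ≥0∞} (hG : Measurable G) (a : ℍ) :
    (∑ ε₁ : Bool, ∫⁻ v₁ : Fin 3 → ℝ, (∑ ε₂ : Bool, ∫⁻ v₂ : Fin 3 → ℝ, (∑ ε₃ : Bool, ∫⁻ v₃ : Fin 3 → ℝ,
        (∫⁻ U, G (fixHistory (ringConfig χ (leaderTuple a ((gnoLetter ε₁ v₁, gnoLetter ε₂ v₂), gnoLetter ε₃ v₃), U)))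
            ∂(Measure.pi fun _ : Fol L => haarProbability SU2)) *
          ENNReal.ofReal (gnomonicWeight v₃ / 4)) * ENNReal.ofReal (gnomonicWeight v₂ / 4)) * ENNReal.ofReal (gnomonicWeight v₁ / 4)) =
      ENNReal.ofReal (1 / 64 * (1 / (2 * Real.pi ^ 2)) ^ Fintype.card (Fol L)) *
        ∑ ε : GnoSign L, ∫⁻ η : GnoCoord L, G (fixHistory (ringConfig χ (blowUpPoint 1 (gnomonicPoint a ε η)))) * ENNReal.ofReal (gnoDensity η) := by
  classical
  rw [show (volume : Measure (GnoCoord L)) = ((volume : Measure (Fin 3 → ℝ)).prod (volume : Measure (Fin 3 → ℝ))).prod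
    ((volume : Measure (Fin 3 → ℝ)).prod (Measure.pi fun _ : Fol L => (volume : Measure (Fin 3 → ℝ)))) from rfl]
  have hGq : Measurable fun q : (Fin 4 → SU2) × (Fol L → SU2) => G (fixHistory (ringConfig χ q)) :=
    hG.comp (measurable_fixHistory.comp (measurable_ringConfig χ))
  -- the joint integrand, as a function of `(ε, η)`, in letter form
  have hΨ : ∀ ε : GnoSign L, Measurable fun η : GnoCoord L =>
      G (fixHistory (ringConfig χ (leaderTuple a ((gnoLetter ε.1.1 η.1.1, gnoLetter ε.1.2 η.1.2), gnoLetter ε.2.1 η.2.1),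
        fun i => quatToSU2 (gnoLetter (ε.2.2 i) (η.2.2 i))))) := fun ε => by
    have h := measurable_gnomonic_integrand χ hG a ε
    simp only [blowUpPoint_one_gnomonicPoint] at h
    exact h
  -- Step F: the followers' Haar integral in gnomonic form, for every leader tuple `C`
  have hF : ∀ C : Fin 4 → SU2, ∫⁻ U, G (fixHistory (ringConfig χ (C, U))) ∂(Measure.pi fun _ : Fol L => haarProbability SU2) =
      ∑ εF : Fol L → Bool, ∫⁻ ηF : Fol L → Fin 3 → ℝ, ENNReal.ofReal (1 / (2 * Real.pi ^ 2)) ^ Fintype.card (Fol L) *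
        (G (fixHistory (ringConfig χ (C, fun i => quatToSU2 (gnoLetter (εF i) (ηF i))))) * ENNReal.ofReal (piWeight ηF)) := fun C => by
    rw [lintegral_haar_pi_eq_gnomonic (fun U : Fol L → SU2 => G (fixHistory (ringConfig χ (C, U))))
      (hGq.comp (measurable_const.prodMk measurable_id)), Finset.mul_sum]
    refine Finset.sum_congr rfl fun εF _ => ?_
    rw [← lintegral_const_mul' _ _ (ENNReal.pow_ne_top ENNReal.ofReal_ne_top)]
    refine lintegral_congr fun ηF => ?_
    rw [prod_ofReal_eq_ofReal_piWeight]
    rfl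
  simp only [hF]
  -- Step A: merge `(ε₃, v₃)` with `(εF, ηF)` (under the outer binders)
  have hA : ∀ (ε₁ ε₂ : Bool) (v₁ v₂ : Fin 3 → ℝ),
      (∑ ε₃ : Bool, ∫⁻ v₃ : Fin 3 → ℝ, (∑ εF : Fol L → Bool, ∫⁻ ηF : Fol L → Fin 3 → ℝ,
          ENNReal.ofReal (1 / (2 * Real.pi ^ 2)) ^ Fintype.card (Fol L) *
            (G (fixHistory (ringConfig χ (leaderTuple a ((gnoLetter ε₁ v₁, gnoLetter ε₂ v₂), gnoLetter ε₃ v₃),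
              fun i => quatToSU2 (gnoLetter (εF i) (ηF i))))) * ENNReal.ofReal (piWeight ηF))) * ENNReal.ofReal (gnomonicWeight v₃ / 4)) =
        ∑ e' : Bool × (Fol L → Bool), ∫⁻ η₂ : (Fin 3 → ℝ) × (Fol L → Fin 3 → ℝ),
          ENNReal.ofReal (1 / (2 * Real.pi ^ 2)) ^ Fintype.card (Fol L) *
            (G (fixHistory (ringConfig χ (leaderTuple a ((gnoLetter ε₁ v₁, gnoLetter ε₂ v₂), gnoLetter e'.1 η₂.1),
              fun i => quatToSU2 (gnoLetter (e'.2 i) (η₂.2 i))))) * ENNReal.ofReal (piWeight η₂.2)) * ENNReal.ofReal (gnomonicWeight η₂.1 / 4)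
          ∂((volume : Measure (Fin 3 → ℝ)).prod (Measure.pi fun _ : Fol L => (volume : Measure (Fin 3 → ℝ)))) := by
    intro ε₁ ε₂ v₁ v₂
    refine sum_lintegral_sum_lintegral_mul (volume : Measure (Fin 3 → ℝ)) (Measure.pi fun _ : Fol L => (volume : Measure (Fin 3 → ℝ)))
      (Φ := fun (ε₃ : Bool) (εF : Fol L → Bool) (p : (Fin 3 → ℝ) × (Fol L → Fin 3 → ℝ)) =>
        ENNReal.ofReal (1 / (2 * Real.pi ^ 2)) ^ Fintype.card (Fol L) *
          (G (fixHistory (ringConfig χ (leaderTuple a ((gnoLetter ε₁ v₁, gnoLetter ε₂ v₂), gnoLetter ε₃ p.1),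
            fun i => quatToSU2 (gnoLetter (εF i) (p.2 i))))) * ENNReal.ofReal (piWeight p.2)))
      (fun ε₃ εF => ?_) measurable_ofReal_gnomonicWeight_div
    have h := (hΨ ((ε₁, ε₂), (ε₃, εF))).comp ((measurable_const (a := (v₁, v₂))).prodMk measurable_id)
    exact measurable_const.mul (h.mul (ENNReal.measurable_ofReal.comp (Gnomonic.continuous_piWeight.measurable.comp measurable_snd)))
  simp only [hA]
  -- Step C: merge `(ε₁, v₁)` with `(ε₂, v₂)`
  rw [sum_lintegral_sum_lintegral_mul (volume : Measure (Fin 3 → ℝ)) (volume : Measure (Fin 3 → ℝ))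
    (Φ := fun (ε₁ ε₂ : Bool) (q : (Fin 3 → ℝ) × (Fin 3 → ℝ)) =>
      (∑ e' : Bool × (Fol L → Bool), ∫⁻ η₂ : (Fin 3 → ℝ) × (Fol L → Fin 3 → ℝ),
          ENNReal.ofReal (1 / (2 * Real.pi ^ 2)) ^ Fintype.card (Fol L) *
            (G (fixHistory (ringConfig χ (leaderTuple a ((gnoLetter ε₁ q.1, gnoLetter ε₂ q.2), gnoLetter e'.1 η₂.1),
              fun i => quatToSU2 (gnoLetter (e'.2 i) (η₂.2 i))))) * ENNReal.ofReal (piWeight η₂.2)) * ENNReal.ofReal (gnomonicWeight η₂.1 / 4)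
          ∂((volume : Measure (Fin 3 → ℝ)).prod (Measure.pi fun _ : Fol L => (volume : Measure (Fin 3 → ℝ))))) *
        ENNReal.ofReal (gnomonicWeight q.2 / 4))
    (fun ε₁ ε₂ => ?hC) measurable_ofReal_gnomonicWeight_div]
  case hC =>
    refine (Finset.measurable_sum _ fun e' _ => ?_).mul (measurable_ofReal_gnomonicWeight_div.comp measurable_snd)
    have h := hΨ ((ε₁, ε₂), e')
    exact ((measurable_const.mul (h.mul (ENNReal.measurable_ofReal.comp
      (Gnomonic.continuous_piWeight.measurable.comp (measurable_snd.comp measurable_snd))))).mul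
      (measurable_ofReal_gnomonicWeight_div.comp (measurable_fst.comp measurable_snd))).lintegral_prod_right'
  -- Step D: merge `((ε₁,ε₂), (v₁,v₂))` with `((ε₃,εF), (v₃,ηF))`
  simp only [mul_assoc]
  rw [sum_lintegral_sum_lintegral_mul ((volume : Measure (Fin 3 → ℝ)).prod (volume : Measure (Fin 3 → ℝ)))
    ((volume : Measure (Fin 3 → ℝ)).prod (Measure.pi fun _ : Fol L => (volume : Measure (Fin 3 → ℝ))))
    (Φ := fun (e : Bool × Bool) (e' : Bool × (Fol L → Bool)) (η : GnoCoord L) =>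
      ENNReal.ofReal (1 / (2 * Real.pi ^ 2)) ^ Fintype.card (Fol L) *
        (G (fixHistory (ringConfig χ (leaderTuple a ((gnoLetter e.1 η.1.1, gnoLetter e.2 η.1.2), gnoLetter e'.1 η.2.1),
          fun i => quatToSU2 (gnoLetter (e'.2 i) (η.2.2 i))))) * (ENNReal.ofReal (piWeight η.2.2) * ENNReal.ofReal (gnomonicWeight η.2.1 / 4))))
    (w := fun q : (Fin 3 → ℝ) × (Fin 3 → ℝ) => ENNReal.ofReal (gnomonicWeight q.2 / 4) * ENNReal.ofReal (gnomonicWeight q.1 / 4))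
    (fun e e' => ?hD) (show Measurable (fun q : (Fin 3 → ℝ) × (Fin 3 → ℝ) => ENNReal.ofReal (gnomonicWeight q.2 / 4) * ENNReal.ofReal (gnomonicWeight q.1 / 4)) from
      (measurable_ofReal_gnomonicWeight_div.comp measurable_snd).mul (measurable_ofReal_gnomonicWeight_div.comp measurable_fst))]
  case hD =>
    have h := hΨ (e, e')
    exact measurable_const.mul (h.mul ((ENNReal.measurable_ofReal.comp (Gnomonic.continuous_piWeight.measurable.comp (measurable_snd.comp measurable_snd))).mul
      (measurable_ofReal_gnomonicWeight_div.comp (measurable_fst.comp measurable_snd))))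
  -- the weights and the constant
  rw [Finset.mul_sum]
  refine Finset.sum_congr rfl fun ε _ => ?_
  rw [← lintegral_const_mul' _ _ ENNReal.ofReal_ne_top]
  refine lintegral_congr fun η => ?_
  rw [blowUpPoint_one_gnomonicPoint]
  exact gnomonic_weights_rearrange (gnomonic_weights_eq η)

/-! ## §4 The joint gnomonic ring chart -/

/-- ★★★ **THE σ-GLUED RING MEASURE IN THE JOINT GNOMONIC CHART** (G1-joint): for a central character `χ` and every measurable seam-gauge-invariant
`G ≥ 0` on the history space,
`∫ G dμ_L = ofReal(coneConst³/64 · (2π²)^{-|Fol L|}) · ∫_cone Σ_{ε : GnoSign L} ∫_{η : GnoCoord L} G(fixHistory (ringConfig χ (blowUpPoint 1 (gnomonicPoint a ε η)))) · gnoDensity η dη da`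
— hub `a` on the cone, three leader letters and all followers on the WHOLE `(ℝ³)^{3+|Fol L|}`, both hemispheres, density `gnoDensity = ρρρ·∏ρ`, no side
condition (✓`lintegral_ringMeasure_eq_chart`, Tonelli, ✓`lintegral_haar_four_eq_gnomonicLeaderChart` for the class function `C ↦ ∫ G dHaar^{Fol}`
(✓`lintegral_pi_chart_conj`), ✓`lintegral_haar_pi_eq_gnomonic`, `gnomonic_fibre_eq`). [cite: tHooft1979] [cite: Luscher1983, §2] -/
theorem lintegral_ringMeasure_eq_gnomonic (κ : Site 3 L → Site 3 L) {χ : Site 3 L → SU2} (hχ : ∀ (x : Site 3 L) (k : SU2), k * χ x = χ x * k)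
    {G : (Fin (2 * L - 1 + 1) → GaugeConfig 3 L SU2) × (Site 3 L → SU2) → ℝ≥0∞} (hG : Measurable G)
    (hinv : ∀ (h : Site 3 L → SU2) (p : (Fin (2 * L - 1 + 1) → GaugeConfig 3 L SU2) × (Site 3 L → SU2)),
      G ((fun i => gaugeTransform h (p.1 i)), h * p.2 * (h ∘ κ)⁻¹) = G p) :
    ∫⁻ p, G p ∂(ringMeasure L) =
      ENNReal.ofReal (coneConst ^ 3 / 64 * (1 / (2 * Real.pi ^ 2)) ^ Fintype.card (Fol L)) *
        ∫⁻ a, (∑ ε : GnoSign L, ∫⁻ η : GnoCoord L,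
          G (fixHistory (ringConfig χ (blowUpPoint 1 (gnomonicPoint a ε η)))) * ENNReal.ofReal (gnoDensity η)) ∂coneMeasure := by
  have hGq : Measurable fun q : (Fin 4 → SU2) × (Fol L → SU2) => G (fixHistory (ringConfig χ q)) :=
    hG.comp (measurable_fixHistory.comp (measurable_ringConfig χ))
  have hg : Measurable fun C : Fin 4 → SU2 => ∫⁻ U, G (fixHistory (ringConfig χ (C, U))) ∂(Measure.pi fun _ : Fol L => haarProbability SU2) :=
    hGq.lintegral_prod_right'
  rw [lintegral_ringMeasure_eq_chart κ χ hG hinv, lintegral_prod _ hGq.aemeasurable,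
    lintegral_haar_four_eq_gnomonicLeaderChart _ hg (fun k C => lintegral_pi_chart_conj κ hχ hG hinv k C)]
  rw [lintegral_congr fun a => gnomonic_fibre_eq χ hG a, lintegral_const_mul' _ _ ENNReal.ofReal_ne_top, ← mul_assoc,
    ← ENNReal.ofReal_mul (pow_nonneg coneConst_pos.le 3)]
  congr 2
  ring

/-- ★ The probability normalisation read off `G ≡ 1` (the cone law is a probability measure): `ofReal(coneConst³/64 · (2π²)^{-|Fol|}) · Σ_ε ∫ gnoDensity = 1`
— the total gnomonic mass is the inverse constant (to pass between `dμ_L`-expectations and chart averages). [folklore] -/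
theorem gnomonic_total_mass {χ : Site 3 L → SU2} (hχ : ∀ (x : Site 3 L) (k : SU2), k * χ x = χ x * k) :
    ENNReal.ofReal (coneConst ^ 3 / 64 * (1 / (2 * Real.pi ^ 2)) ^ Fintype.card (Fol L)) *
        (∑ _ε : GnoSign L, ∫⁻ η : GnoCoord L, ENNReal.ofReal (gnoDensity η)) = 1 := by
  haveI : IsProbabilityMeasure (ringMeasure L) := isProbabilityMeasure_ringMeasure (L := L)
  haveI := isProbabilityMeasure_coneMeasure
  have h := lintegral_ringMeasure_eq_gnomonic (L := L) id hχ (G := fun _ => 1) measurable_const (fun _ _ => rfl)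
  simp only [lintegral_const, measure_univ, mul_one, one_mul] at h
  exact h.symm

end Summit.QuantumFields.YangMills.Theorems.SwapVirialDeficit.BlowUpRing

end
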